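import Summits.BirchSwinnertonDyer.BirchSwinnertonDyer.Theorems.KatoDescentTamePotSupersingularTameLowerVisibilityNn
import Summits.BirchSwinnertonDyer.BirchSwinnertonDyer.Theorems.Rank2ObservatoryKernelWalker
import Summits.BirchSwinnertonDyer.Rank1Residual.X4.VisibilityRankOneFreePlaces
import Summits.BirchSwinnertonDyer.Rank1Residual.GaloisImage.PadicTwistClassDecider
import Literature.NumberTheory.GaloisRepresentations.LocalH2VanishingTrivialModule
import Literature.NumberTheory.GaloisRepresentations.TateLevelOneLocalGenerators
import HarnessLib

/-!
# Route `KatoDescentTamePotSupersingular` (rung K8-t′, cell `bsd-potss`), open core `TameLowerIntrinsicNonCM`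
# (item stmt-BirchSwinnertonDyer-19618), registered stub `stub_intr_kuriharaCerts_offSeed` — the Kurihara lane's RESIDUE at
# `p = 5`, L₀ PER CLASS by VISIBILITY — FILE 02 of 2: `492450fq1` (free place `2`) and `201150f1` (free place `149`)
# (a `--supports … --as helper` file; seat `bsd-potss-k8t-c2` generation 8)

PARTITION (D-0054, cell bsd-potss): EXCLUDED-DOMAIN non-CM additive `p` · B4 (t′) (`e ∈ {3,4,6}`), `r_an = 0`, LOWER half
L₀ — harvests-a-certificate (visibility, free-place count) on two rows of the Kurihara lane's residue; closes NONE;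
shrinks-literal none; books nothing.  Continuation of `…TameLowerVisibilityOffSeed01.lean` (independent module: FILE 01 is not imported; same seat, same kit job j262735,
same roads; its module docstring has the table of the four rows, the roads, the kernel / binder split and the honest label,
all of which apply verbatim here):

| `W` (target, `#Ш_an = 25`, tors `1`, Kodaira at `5`) | `F` (rank `2`, kernel) | `S` | free place (kind (iii′)) |
|---|---|---|---|
| `492450fq1` `[1,1,1,-1336180553513,-594487844304328969]` (`IV*`) | `492450es1` `[1,1,1,-12888,5812281]` | `{2,3,5,7,67}` | `2` (both `I₅`) |
| `201150f1` `[1,-1,1,-115603241180,-15128723997763553]` (`IV*`) | `201150c1` `[1,-1,1,-28055,3766447]` | `{2,3,5,149}` | `149` (`I₂` / `I₁`, both non-split) |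

Road: `X4.exists_sha_ne_zero_of_congr_of_rank_add_of_freePlaces` (x11c gen 25) — kind (i) places by x10b's decider
`fiveTorsionCheckAt` (kernel), the one kind-(iii′) place by p17's `sqFlagAt` / the `j`-denominator test / `5 ∤ w(w−1)` (kernel),
FREE by Tate's uniformisation (binder `hU2`); `2 ≤ rank F` by the rank-≥2 observatory's certificate check (kernel); then
Cassels–Tate (`hCT`) + GZK (`hGZK`).  BINDERS: `hCT`, `hGZK`, `hU2`, Cremona's `r_an = 0` / `#Ш_an`, and `θ : F[5] ⥲ W[5]`
(Kraus–Oesterlé two-engine evidence, kit j262735).  HONEST LABEL: per-class certificates; the stub and the item stay OPEN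
(class-wide = Kato Conj. 12.10 at an additive potentially supersingular prime); nothing booked; BSD is not proved by any of this.

References: [CremonaMazur2000] §3, Table 1; [AgasheStein2002] Thm. 3.1; [KrausOesterle1992] Prop. 4; [SilvermanAEC2009]
VII.3.1(b), VII.5 Prop. 5.1(a), VIII.6.7, X.4.14; [SilvermanATAEC1994] V Lemma 5.2 (c), Thm. 5.3, Cor. 5.4; [Mazur1978]
Prop. 6.3; [Kato2004Asterisque] Conj. 12.10; [Kurihara2014b] Thm. B; [Cremona2006] Table 1.
-/
set_option autoImplicit false
-- sibling precedent (`KatoDescentTamePotSupersingularTameLowerVisibilityNn.lean`): the directory name repeats the summit name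
set_option linter.dupNamespace false

noncomputable section

open scoped Classical

open WeierstrassCurve Literature.NumberTheory.EllipticCurves
  Literature.NumberTheory.EllipticCurves.Rank1Residual
  Literature.NumberTheory.EllipticCurves.Rank1Residual.Typed
  Literature.NumberTheory.EllipticCurves.Rank1Residual.X11RankOneCertificates
  Summit.BirchSwinnertonDyer.BirchSwinnertonDyer.Rank1Residual.IntModel
  Summit.BirchSwinnertonDyer.BirchSwinnertonDyer.Rank1Residual.X11RankOne
  Summit.BirchSwinnertonDyer.BirchSwinnertonDyer.Rank2Observatory
  Summit.BirchSwinnertonDyer.Rank1Residual.X11b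
  Summit.BirchSwinnertonDyer.Rank1Residual.GaloisImage
  Summit.BirchSwinnertonDyer.Rank1Residual.Supersingular
  Summit.BirchSwinnertonDyer.Rank1Residual.Supersingular.LocalOddTorsion
open NumberField IsDedekindDomain Rat.HeightOneSpectrum

namespace Summit.BirchSwinnertonDyer.BirchSwinnertonDyer.Theorems.KTVis

/-! ## §0 Private local copies of FILE 01's plumbing (so that this file does not import FILE 01; proofs verbatim) -/

/-- Local copy of FILE 01's `mem_placesOfList_iff`. [folklore] -/
private theorem mem_placesOfList_iff' {L : List ℕ} (hL : ∀ r ∈ L, r.Prime) (w : HeightOneSpectrum (𝓞 ℚ)) :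
    w ∈ (L.filterMap fun r ↦ if h : r.Prime then some ((primesEquiv (R := 𝓞 ℚ)).symm ⟨r, h⟩) else none).toFinset ↔
      (primesEquiv w : ℕ) ∈ L := by
  rw [List.mem_toFinset, List.mem_filterMap]
  constructor
  · rintro ⟨r, hr, hrw⟩
    rw [dif_pos (hL r hr), Option.some.injEq] at hrw
    rw [← hrw, Equiv.apply_symm_apply]; exact hr
  · intro hw
    refine ⟨(primesEquiv w : ℕ), hw, ?_⟩
    rw [dif_pos (primesEquiv w).2]; simp

/-- Local copy of FILE 01's `good_outside_placesOfList`. [cite: SilvermanAEC2009, VII.5 Prop. 5.1(a)] -/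
private theorem good_outside_placesOfList' {L : List ℕ} (hL : ∀ r ∈ L, r.Prime) (h5 : 5 ∈ L)
    (a₁ a₂ a₃ a₄ a₆ b₁ b₂ b₃ b₄ b₆ : ℤ)
    (hΔE : ∀ r : ℕ, r.Prime → (r : ℤ) ∣ (⟨a₁, a₂, a₃, a₄, a₆⟩ : WeierstrassCurve ℤ).Δ → r ∈ L)
    (hΔF : ∀ r : ℕ, r.Prime → (r : ℤ) ∣ (⟨b₁, b₂, b₃, b₄, b₆⟩ : WeierstrassCurve ℤ).Δ → r ∈ L)
    (W F : WeierstrassCurve ℚ) (hWeq : W = ⟨a₁, a₂, a₃, a₄, a₆⟩) (hFeq : F = ⟨b₁, b₂, b₃, b₄, b₆⟩) :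
    ∀ w : HeightOneSpectrum (𝓞 ℚ),
      w ∉ (L.filterMap fun r ↦ if h : r.Prime then some ((primesEquiv (R := 𝓞 ℚ)).symm ⟨r, h⟩) else none).toFinset →
      W.HasGoodReductionAt w ∧ F.HasGoodReductionAt w ∧ ((5 : ℕ) : 𝓞 ℚ) ∉ w.asIdeal := by
  intro w hwS
  have hwL : (primesEquiv w : ℕ) ∉ L := fun h ↦ hwS ((mem_placesOfList_iff' hL w).mpr h)
  have hqp : (primesEquiv w : ℕ).Prime := (primesEquiv w).2
  refine ⟨?_, ?_, natCast_not_mem_of_primesEquiv_ne w Fact.out fun h ↦ hwL (h ▸ h5)⟩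
  · rw [hWeq]
    exact hasGoodReductionAt_mk_of_primesEquiv _ _ _ _ _ w rfl fun h ↦ hwL (hΔE _ hqp (by exact_mod_cast h))
  · rw [hFeq]
    exact hasGoodReductionAt_mk_of_primesEquiv _ _ _ _ _ w rfl fun h ↦ hwL (hΔF _ hqp (by exact_mod_cast h))

/-- Local copy of FILE 01's `missingLower5_of_visible`. [cite: SilvermanAEC2009, Thm. X.4.14] -/
private theorem missingLower5_of_visible' (hCT : exists_casselsTate_pairing (K := ℚ))
    (hGZK : rank_eq_analyticRank_of_analyticRank_le_one)
    (W : WeierstrassCurve ℚ) [W.IsElliptic] (hr0 : W.analyticRank = 0) {q : ℚ} (hq : shaAn W = (q : ℂ))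
    (hv : padicValRat 5 q ≤ 2) (hc : ∃ c : W.sha, c ≠ 0 ∧ (5 : ℕ) • c = 0) : MissingLowerBoundAt W 5 := by
  haveI : Fact (Nat.Prime 5) := ⟨by norm_num⟩
  have hfinSha : W.ShaFinite := (hGZK W (by rw [hr0]; norm_num)).2
  exact missingLowerBoundAt_of_casselsTate_of_pow_dvd W 5 hCT hfinSha hq (k := 1) (by simpa using hv)
    (by simpa using dvd_shaOrder_of_exists_torsion W 5 hc)

/-! ## §4 `492450fq1 @ 5` ← the rank-`2` curve `492450es1`; the place `2` FREE (kind (iii′)) -/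

/-- **`2 ≤ rank_ℤ F(ℚ)` for `F = 492450es1` in the kernel**: the rank-≥2 observatory's certificate row (walker list W98a6, segment 2:
points `(-15, 2457)`, `(1385, 50757)` (the certificate uses `-(1385, 50757) = (1385, -52143)`), sum `(111, 2345)`, killers `(11, 15)`, `(19, 19)`, `t = 1`, witnesses at `17, 31, 17`) re-checked here by ONE `decide +kernel` of `Cert.check`.
[cite: SilvermanAEC2009, Thm. VIII.6.7] [cite: Cremona2006, Table 1 (label 492450es1)] -/
theorem two_le_rank_c492450es1 :
    2 ≤ ((⟨1, 1, 1, -12888, 5812281⟩ : WeierstrassCurve ℤ).map (Int.castRingHom ℚ)).mordellWeilRank :=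
  two_le_mordellWeilRank_of_certCheck _
    (.odd ⟨-15, 2457, 1385, -52143, 111, 2345, [(11, 15), (19, 19)], 1, 17, 31, 17, 2, 9, 21, 30, 9, 16⟩)
    (by decide +kernel)

/-- **Kind (iii′) at the place of `2` for `492450fq1 ~ 492450es1`, `p = 5`, in the kernel** (both `I₅` at `2`): both
`j`-invariants have `2 ∣ den` (`j(W) = 5740779654215124531731038137505/49901157589270719559968`, `j(F) = -5151505/315168`), the twist classes
`γ = −c₄/c₆` agree up to a square in `ℚ₂` (`γ(W)/γ(F) = -245520395270947/241993416498416501`, a `2`-adic unit with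
`sqFlagAt 2 (N·D) 0 = true`), and `μ₅(ℚ₂) = 1` (`5 ∤ 2`, `5 ∤ 1`). [cite: SilvermanATAEC1994, Ch. V Lemma 5.2 (c), Thm. 5.3, Cor. 5.4]
[cite: NeukirchANT1999, II §5 Prop. (5.3) and (5.7)] -/
theorem kindIIIPrime_v492450fq1_at2 (W W' : WeierstrassCurve ℚ) [W.IsElliptic] [W'.IsElliptic]
    (hW : W = ⟨1, 1, 1, -1336180553513, -594487844304328969⟩) (hW' : W' = ⟨1, 1, 1, -12888, 5812281⟩)
    {v : HeightOneSpectrum (𝓞 ℚ)} (hv : (primesEquiv v : ℕ) = 2) :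
    1 < v.valuation ℚ W.j ∧ 1 < v.valuation ℚ W'.j ∧
      (∃ r : v.adicCompletion ℚ, algebraMap ℚ (v.adicCompletion ℚ) (-(W.c₄ / W.c₆)) =
        r ^ 2 * algebraMap ℚ (v.adicCompletion ℚ) (-(W'.c₄ / W'.c₆))) ∧
      (∀ ζ : v.adicCompletion ℚ, ζ ^ 5 = 1 → ζ = 1) := by
  haveI : Fact (Nat.Prime 2) := ⟨by norm_num⟩
  haveI : Fact (Nat.Prime 5) := ⟨by norm_num⟩
  have hj : W.j = 5740779654215124531731038137505 / 49901157589270719559968 := by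
    rw [WeierstrassCurve.j_eq_c₄_pow_three_div_Δ]; subst hW
    norm_num [WeierstrassCurve.c₄, WeierstrassCurve.Δ, WeierstrassCurve.b₂, WeierstrassCurve.b₄,
      WeierstrassCurve.b₆, WeierstrassCurve.b₈]
  have hj' : W'.j = -5151505 / 315168 := by
    rw [WeierstrassCurve.j_eq_c₄_pow_three_div_Δ]; subst hW'
    norm_num [WeierstrassCurve.c₄, WeierstrassCurve.Δ, WeierstrassCurve.b₂, WeierstrassCurve.b₄,
      WeierstrassCurve.b₆, WeierstrassCurve.b₈]
  have hA : -(W.c₄ / W.c₆) = -10471292501 / 83859104727174035 := by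
    subst hW
    norm_num [WeierstrassCurve.c₄, WeierstrassCurve.c₆, WeierstrassCurve.b₂, WeierstrassCurve.b₄,
      WeierstrassCurve.b₆]
  have hB : -(W'.c₄ / W'.c₆) = 101 / 820645 := by
    subst hW'
    norm_num [WeierstrassCurve.c₄, WeierstrassCurve.c₆, WeierstrassCurve.b₂, WeierstrassCurve.b₄,
      WeierstrassCurve.b₆]
  refine ⟨TwistedKummer.one_lt_valuation_of_eq_of_dvd_den v hv hj (by norm_num) (by decide +kernel),
    TwistedKummer.one_lt_valuation_of_eq_of_dvd_den v hv hj' (by norm_num) (by decide +kernel), ?_, ?_⟩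
  · rw [hA, hB]
    exact LocalTorsion3At.exists_eq_sq_mul_of_sqFlagAt v hv (by norm_num) (D := 241993416498416501)
      (by norm_num) (N := -245520395270947) (by norm_num) (w := 0) (by norm_num) (by decide +kernel)
      (by decide +kernel)
  · have hcard : Literature.NumberTheory.GaloisRepresentations.IsNonarchimedeanLocalField.residueFieldCard
        (v.adicCompletion ℚ) = 2 :=
      Literature.NumberTheory.GaloisRepresentations.residueFieldCard_adicCompletion_rat 2 v hv
    exact Literature.NumberTheory.GaloisRepresentations.forall_pow_eq_one_imp_eq_one_of_not_dvd
      (F := v.adicCompletion ℚ) (p := 5) (by rw [hcard]; norm_num) (by rw [hcard]; norm_num)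


/-- **L₀ at `5` for `492450fq1` by VISIBILITY, FREE PLACE `2`** (`N = 492450 = 2·3·5²·7²·67`, (t′) at `5`: Kodaira `IV*`,
`e = 3`; `ρ̄_{W,5}` onto; `r_an = 0`, `#Ш_an = 25`, torsion `1`, `∏ c_ℓ = 10`; single-curve class; kt-kur5 residue «k = 2 Tamagawa row: Kolyvagin primes `ℓ ≡ 1 (25)`, pair levels out of reach»):
`MissingLowerBoundAt W 5` from Cassels–Tate (`hCT`), GZK (`hGZK`), Tate's uniformisation (`hU2`), Cremona's `r_an = 0` /
`#Ш_an` (`hr0`, `hq`, `hv`) and a `Γ_ℚ`-isomorphism `θ : F[5] ⥲ W[5]` from the RANK-2 curve `F = 492450es1` of the same conductor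
(Kraus–Oesterlé mod `5` to the printed bound, two engines, kit j262735).  KERNEL: `W[5]` irreducible (`ℓ = 17`,
`#W̃(𝔽₁₇) = 24`, `X² + 6X + 17` rootless mod `5`), `S = {2, 3, 5, 7, 67}` with good reduction outside (`|Δ_W| = 2⁵3⁷5⁸7¹²67⁷`,
`|Δ_F| = 2⁵3·5⁸7⁸67`), kind (i) at `3`, `5`, `7`, `67` (`#F(ℚ_w)[5] = 1`, decider), kind (iii′) at `2`
(`kindIIIPrime_v492450fq1_at2`), `2 ≤ rank F(ℚ)` (`two_le_rank_c492450es1`), `rank W = 0` (GZK); the free-place count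
`X4.exists_sha_ne_zero_of_congr_of_rank_add_of_freePlaces` gives `Ш(W)[5] ≠ 0`, hence `ord₅ #Ш ≥ 2 = ord₅ #Ш_an`.  Per class;
stub / item NOT closed; nothing booked.
[cite: CremonaMazur2000, §3 and Table 1] [cite: AgasheStein2002, Thm. 3.1] [cite: KrausOesterle1992, Prop. 4]
[cite: SilvermanATAEC1994, Ch. V Thm. 5.3, Cor. 5.4] [cite: Mazur1978, Prop. 6.3 (1)]
[cite: SilvermanAEC2009, VII.5 Prop. 5.1(a), Thm. X.4.14] [cite: Cremona2006, Table 1 (labels 492450fq1, 492450es1)] -/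
theorem missingLower5_vis_492450fq1 (hCT : exists_casselsTate_pairing (K := ℚ))
    (hGZK : rank_eq_analyticRank_of_analyticRank_le_one)
    (hU2 : Silverman1994_thmV53_corV54_tateUniformisation.{0})
    (W : WeierstrassCurve ℚ) [W.IsElliptic] [W.IsGloballyMinimal] (hWeq : W = ⟨1, 1, 1, -1336180553513, -594487844304328969⟩)
    (hr0 : W.analyticRank = 0) {q : ℚ} (hq : shaAn W = (q : ℂ)) (hv : padicValRat 5 q ≤ 2)
    (F : WeierstrassCurve ℚ) (hFeq : F = ⟨1, 1, 1, -12888, 5812281⟩)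
    (θ : geomTorsion F (5 : ℤ) ≃+ geomTorsion W (5 : ℤ))
    (hθ : ∀ (σ : Field.absoluteGaloisGroup ℚ) (P : geomTorsion F (5 : ℤ)), θ (σ • P) = σ • θ P) :
    MissingLowerBoundAt W 5 := by
  haveI hFell : F.IsElliptic := by
    rw [hFeq]
    exact Summit.BirchSwinnertonDyer.Rank1Residual.X11b.isElliptic_of_discOf_ne_zero 1 1 1 (-12888) 5812281
      (by decide +kernel)
  have hIW : integralModelInt W = ⟨1, 1, 1, -1336180553513, -594487844304328969⟩ :=
    integralModelInt_eq_of_map_eq _ (by rw [hWeq]; exact map_mk_int 1 1 1 (-1336180553513) (-594487844304328969))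
  -- `W[5]` irreducible: Frobenius witness at `ℓ = 17` (`#W̃(𝔽₁₇) = 24`, `a = -6`)
  have hirr : Irr W 5 :=
    hasIrreducibleModPGaloisRep_of_intModel_of_noroot hIW 5 17 (by norm_num) (by decide +kernel)
      (natCard_point_eq_of_countPoints 1 1 1 (-1336180553513) (-594487844304328969) 17 (by norm_num)
        (by decide +kernel) (n := 24) (by decide +kernel)) (by decide)
  have hrank : W.mordellWeilRank + Module.finrank ℚ ℚ + 1 ≤ F.mordellWeilRank := by
    have h2 := two_le_rank_c492450es1
    have hE : (⟨1, 1, 1, -12888, 5812281⟩ : WeierstrassCurve ℤ).map (Int.castRingHom ℚ) =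
        (⟨1, 1, 1, -12888, 5812281⟩ : WeierstrassCurve ℚ) := by
      ext <;> simp [WeierstrassCurve.map]
    rw [hE] at h2
    rw [(hGZK W (by rw [hr0]; norm_num)).1, hr0, Module.finrank_self, hFeq]
    exact h2
  have hk3 : ∀ w : HeightOneSpectrum (𝓞 ℚ), (primesEquiv w : ℕ) = 3 →
      Nat.card (nsmulAddMonoidHom 5 : (F.baseChange (w.adicCompletion ℚ)).toAffine.Point →+ _).ker = 1 :=
    fun w hw ↦
      natCard_ker_nsmul_five_adicCompletion_eq_one_of_checkAt 3 1 1 1 (-12888) 5812281 (by decide +kernel)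
        (k := 1) (cert := []) (by decide +kernel) F hFeq hw
  have hk5 : ∀ w : HeightOneSpectrum (𝓞 ℚ), (primesEquiv w : ℕ) = 5 →
      Nat.card (nsmulAddMonoidHom 5 : (F.baseChange (w.adicCompletion ℚ)).toAffine.Point →+ _).ker = 1 :=
    fun w hw ↦
      natCard_ker_nsmul_five_adicCompletion_eq_one_of_checkAt 5 1 1 1 (-12888) 5812281 (by decide +kernel)
        (k := 13) (cert := [(175134311019436380, 12, 25, 3), (1806731399751415, 12, 25, 3)]) (by decide +kernel) F hFeq hw
  have hk7 : ∀ w : HeightOneSpectrum (𝓞 ℚ), (primesEquiv w : ℕ) = 7 →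
      Nat.card (nsmulAddMonoidHom 5 : (F.baseChange (w.adicCompletion ℚ)).toAffine.Point →+ _).ker = 1 :=
    fun w hw ↦
      natCard_ker_nsmul_five_adicCompletion_eq_one_of_checkAt 7 1 1 1 (-12888) 5812281 (by decide +kernel)
        (k := 2) (cert := []) (by decide +kernel) F hFeq hw
  have hk67 : ∀ w : HeightOneSpectrum (𝓞 ℚ), (primesEquiv w : ℕ) = 67 →
      Nat.card (nsmulAddMonoidHom 5 : (F.baseChange (w.adicCompletion ℚ)).toAffine.Point →+ _).ker = 1 :=
    fun w hw ↦ by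
      haveI : Fact (Nat.Prime 67) := ⟨by norm_num⟩
      exact natCard_ker_nsmul_five_adicCompletion_eq_one_of_checkAt 67 1 1 1 (-12888) 5812281 (by decide +kernel)
        (k := 1) (cert := []) (by decide +kernel) F hFeq hw
  set L : List ℕ := [2, 3, 5, 7, 67] with hL
  have hLp : ∀ r ∈ L, r.Prime := by decide
  have hΔE : ∀ r : ℕ, r.Prime → (r : ℤ) ∣ (⟨1, 1, 1, -1336180553513, -594487844304328969⟩ : WeierstrassCurve ℤ).Δ → r ∈ L :=
    forall_mem_of_natAbs_eq_prod_pow L [5, 7, 8, 12, 7] hLp (by decide +kernel)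
  have hΔF : ∀ r : ℕ, r.Prime → (r : ℤ) ∣ (⟨1, 1, 1, -12888, 5812281⟩ : WeierstrassCurve ℤ).Δ → r ∈ L :=
    forall_mem_of_natAbs_eq_prod_pow L [5, 1, 8, 8, 1] hLp (by decide +kernel)
  set S : Finset (HeightOneSpectrum (𝓞 ℚ)) :=
    (L.filterMap fun r ↦ if h : r.Prime then some ((primesEquiv (R := 𝓞 ℚ)).symm ⟨r, h⟩) else none).toFinset
    with hSdef
  have hS := good_outside_placesOfList' hLp (by decide) _ _ _ _ _ _ _ _ _ _ hΔE hΔF W F hWeq hFeq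
  have hplaces : ∀ w ∈ S,
      Nat.card (nsmulAddMonoidHom 5 : (F.baseChange (w.adicCompletion ℚ)).toAffine.Point →+ _).ker = 1 ∨
      (1 < w.valuation ℚ W.j ∧ 1 < w.valuation ℚ F.j ∧
        (∃ r : w.adicCompletion ℚ, algebraMap ℚ (w.adicCompletion ℚ) (-(W.c₄ / W.c₆)) =
          r ^ 2 * algebraMap ℚ (w.adicCompletion ℚ) (-(F.c₄ / F.c₆))) ∧
        (∀ ζ : w.adicCompletion ℚ, ζ ^ 5 = 1 → ζ = 1)) := by
    intro w hwS
    have hwL : (primesEquiv w : ℕ) ∈ L := (mem_placesOfList_iff' hLp w).mp hwS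
    have hcases : (primesEquiv w : ℕ) = 2 ∨ (primesEquiv w : ℕ) = 3 ∨ (primesEquiv w : ℕ) = 5 ∨ (primesEquiv w : ℕ) = 7 ∨ (primesEquiv w : ℕ) = 67 := by
      simp only [hL, List.mem_cons, List.mem_nil_iff, or_false] at hwL
      omega
    rcases hcases with hw | hw | hw | hw | hw
    · exact Or.inr (kindIIIPrime_v492450fq1_at2 W F hWeq hFeq hw)
    · exact Or.inl (hk3 w hw)
    · exact Or.inl (hk5 w hw)
    · exact Or.inl (hk7 w hw)
    · exact Or.inl (hk67 w hw)
  exact missingLower5_of_visible' hCT hGZK W hr0 hq hv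
    (Summit.BirchSwinnertonDyer.Rank1Residual.X4.exists_sha_ne_zero_of_congr_of_rank_add_of_freePlaces W F hU2
      (by norm_num) θ hθ S hS
      ((natCard_torsionBy_point_eq_of_subsingleton W _ _ _).trans
        (natCard_torsionBy_eq_one_of_hasIrreducibleModPGaloisRep W 5 hirr)) hrank hplaces)

/-! ## §5 `201150f1 @ 5` ← the rank-`2` curve `201150c1`; the place `149` FREE (kind (iii′)) -/

/-- **`2 ≤ rank_ℤ F(ℚ)` for `F = 201150c1` in the kernel**: the rank-≥2 observatory's certificate row (walker list W40a3, segment 4: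
points `(163, 1790)`, `(119, 1390)` (used as `(119, -1510)`), sum `(5419, -401410)`, killers `(7, 9)`, `(11, 9)`, torsion annihilator `t = 9` (`F(ℚ)_tors = ℤ/3`), witnesses at `13, 13, 17`) re-checked here by ONE `decide +kernel` of `Cert.check`.
[cite: SilvermanAEC2009, Thm. VIII.6.7] [cite: Cremona2006, Table 1 (label 201150c1)] -/
theorem two_le_rank_c201150c1 :
    2 ≤ ((⟨1, -1, 1, -28055, 3766447⟩ : WeierstrassCurve ℤ).map (Int.castRingHom ℚ)).mordellWeilRank :=
  two_le_mordellWeilRank_of_certCheck _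
    (.odd ⟨163, 1790, 119, -1510, 5419, -401410, [(7, 9), (11, 9)], 9, 13, 13, 17, 7, 9, 2, 11, 13, 11⟩)
    (by decide +kernel)

/-- **Kind (iii′) at the place of `149` for `201150f1 ~ 201150c1`, `p = 5`, in the kernel** (`I₂` for `W`, `I₁` for `F` (non-split, `#F̃_ns(𝔽₁₄₉) = 150`) at `149`): both
`j`-invariants have `149 ∣ den` (`j(W) = 16199810902091046912186436491555/1454964736`, `j(F) = -317605995/610304`), the twist classes
`γ = −c₄/c₆` agree up to a square in `ℚ₁₄₉` (`γ(W)/γ(F) = -35163114938453/34340251912709491`, a `149`-adic unit with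
`sqFlagAt 149 (N·D) 0 = true`), and `μ₅(ℚ₁₄₉) = 1` (`5 ∤ 149`, `5 ∤ 148`). [cite: SilvermanATAEC1994, Ch. V Lemma 5.2 (c), Thm. 5.3, Cor. 5.4]
[cite: NeukirchANT1999, II §5 Prop. (5.3) and (5.7)] -/
theorem kindIIIPrime_v201150f1_at149 (W W' : WeierstrassCurve ℚ) [W.IsElliptic] [W'.IsElliptic]
    (hW : W = ⟨1, -1, 1, -115603241180, -15128723997763553⟩) (hW' : W' = ⟨1, -1, 1, -28055, 3766447⟩)
    {v : HeightOneSpectrum (𝓞 ℚ)} (hv : (primesEquiv v : ℕ) = 149) :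
    1 < v.valuation ℚ W.j ∧ 1 < v.valuation ℚ W'.j ∧
      (∃ r : v.adicCompletion ℚ, algebraMap ℚ (v.adicCompletion ℚ) (-(W.c₄ / W.c₆)) =
        r ^ 2 * algebraMap ℚ (v.adicCompletion ℚ) (-(W'.c₄ / W'.c₆))) ∧
      (∀ ζ : v.adicCompletion ℚ, ζ ^ 5 = 1 → ζ = 1) := by
  haveI : Fact (Nat.Prime 149) := ⟨by norm_num⟩
  haveI : Fact (Nat.Prime 5) := ⟨by norm_num⟩
  have hj : W.j = 16199810902091046912186436491555 / 1454964736 := by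
    rw [WeierstrassCurve.j_eq_c₄_pow_three_div_Δ]; subst hW
    norm_num [WeierstrassCurve.c₄, WeierstrassCurve.Δ, WeierstrassCurve.b₂, WeierstrassCurve.b₄,
      WeierstrassCurve.b₆, WeierstrassCurve.b₈]
  have hj' : W'.j = -317605995 / 610304 := by
    rw [WeierstrassCurve.j_eq_c₄_pow_three_div_Δ]; subst hW'
    norm_num [WeierstrassCurve.c₄, WeierstrassCurve.Δ, WeierstrassCurve.b₂, WeierstrassCurve.b₄,
      WeierstrassCurve.b₆, WeierstrassCurve.b₈]
  have hA : -(W.c₄ / W.c₆) = -4932404957 / 11618882226104715 := by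
    subst hW
    norm_num [WeierstrassCurve.c₄, WeierstrassCurve.c₆, WeierstrassCurve.b₂, WeierstrassCurve.b₄,
      WeierstrassCurve.b₆]
  have hB : -(W'.c₄ / W'.c₆) = 133 / 320805 := by
    subst hW'
    norm_num [WeierstrassCurve.c₄, WeierstrassCurve.c₆, WeierstrassCurve.b₂, WeierstrassCurve.b₄,
      WeierstrassCurve.b₆]
  refine ⟨TwistedKummer.one_lt_valuation_of_eq_of_dvd_den v hv hj (by norm_num) (by decide +kernel),
    TwistedKummer.one_lt_valuation_of_eq_of_dvd_den v hv hj' (by norm_num) (by decide +kernel), ?_, ?_⟩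
  · rw [hA, hB]
    exact LocalTorsion3At.exists_eq_sq_mul_of_sqFlagAt v hv (by norm_num) (D := 34340251912709491)
      (by norm_num) (N := -35163114938453) (by norm_num) (w := 0) (by norm_num) (by decide +kernel)
      (by decide +kernel)
  · have hcard : Literature.NumberTheory.GaloisRepresentations.IsNonarchimedeanLocalField.residueFieldCard
        (v.adicCompletion ℚ) = 149 :=
      Literature.NumberTheory.GaloisRepresentations.residueFieldCard_adicCompletion_rat 149 v hv
    exact Literature.NumberTheory.GaloisRepresentations.forall_pow_eq_one_imp_eq_one_of_not_dvd
      (F := v.adicCompletion ℚ) (p := 5) (by rw [hcard]; norm_num) (by rw [hcard]; norm_num)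


/-- **L₀ at `5` for `201150f1` by VISIBILITY, FREE PLACE `149`** (`N = 201150 = 2·3³·5²·149`, (t′) at `5`: Kodaira `IV*`,
`e = 3`; `ρ̄_{W,5}` onto; `r_an = 0`, `#Ш_an = 25`, torsion `1`, `∏ c_ℓ = 32`; single-curve class; kt-kur5 residue «pass-2 timeout row»):
`MissingLowerBoundAt W 5` from Cassels–Tate (`hCT`), GZK (`hGZK`), Tate's uniformisation (`hU2`), Cremona's `r_an = 0` /
`#Ш_an` (`hr0`, `hq`, `hv`) and a `Γ_ℚ`-isomorphism `θ : F[5] ⥲ W[5]` from the RANK-2 curve `F = 201150c1` of the same conductor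
(Kraus–Oesterlé mod `5` to the printed bound, two engines, kit j262735).  KERNEL: `W[5]` irreducible (`ℓ = 7`,
`#W̃(𝔽₇) = 4`, `X² − 4X + 7` rootless mod `5`), `S = {2, 3, 5, 149}` with good reduction outside (`|Δ_W| = 2¹⁶3³5⁸149²`,
`|Δ_F| = 2¹²3⁹5⁸149`), kind (i) at `2`, `3`, `5` (`#F(ℚ_w)[5] = 1`, decider), kind (iii′) at `149`
(`kindIIIPrime_v201150f1_at149`), `2 ≤ rank F(ℚ)` (`two_le_rank_c201150c1`), `rank W = 0` (GZK); the free-place count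
`X4.exists_sha_ne_zero_of_congr_of_rank_add_of_freePlaces` gives `Ш(W)[5] ≠ 0`, hence `ord₅ #Ш ≥ 2 = ord₅ #Ш_an`.  Per class;
stub / item NOT closed; nothing booked.
[cite: CremonaMazur2000, §3 and Table 1] [cite: AgasheStein2002, Thm. 3.1] [cite: KrausOesterle1992, Prop. 4]
[cite: SilvermanATAEC1994, Ch. V Thm. 5.3, Cor. 5.4] [cite: Mazur1978, Prop. 6.3 (1)]
[cite: SilvermanAEC2009, VII.5 Prop. 5.1(a), Thm. X.4.14] [cite: Cremona2006, Table 1 (labels 201150f1, 201150c1)] -/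
theorem missingLower5_vis_201150f1 (hCT : exists_casselsTate_pairing (K := ℚ))
    (hGZK : rank_eq_analyticRank_of_analyticRank_le_one)
    (hU2 : Silverman1994_thmV53_corV54_tateUniformisation.{0})
    (W : WeierstrassCurve ℚ) [W.IsElliptic] [W.IsGloballyMinimal] (hWeq : W = ⟨1, -1, 1, -115603241180, -15128723997763553⟩)
    (hr0 : W.analyticRank = 0) {q : ℚ} (hq : shaAn W = (q : ℂ)) (hv : padicValRat 5 q ≤ 2)
    (F : WeierstrassCurve ℚ) (hFeq : F = ⟨1, -1, 1, -28055, 3766447⟩)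
    (θ : geomTorsion F (5 : ℤ) ≃+ geomTorsion W (5 : ℤ))
    (hθ : ∀ (σ : Field.absoluteGaloisGroup ℚ) (P : geomTorsion F (5 : ℤ)), θ (σ • P) = σ • θ P) :
    MissingLowerBoundAt W 5 := by
  haveI hFell : F.IsElliptic := by
    rw [hFeq]
    exact Summit.BirchSwinnertonDyer.Rank1Residual.X11b.isElliptic_of_discOf_ne_zero 1 (-1) 1 (-28055) 3766447
      (by decide +kernel)
  have hIW : integralModelInt W = ⟨1, -1, 1, -115603241180, -15128723997763553⟩ :=
    integralModelInt_eq_of_map_eq _ (by rw [hWeq]; exact map_mk_int 1 (-1) 1 (-115603241180) (-15128723997763553))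
  -- `W[5]` irreducible: Frobenius witness at `ℓ = 7` (`#W̃(𝔽₇) = 4`, `a = 4`)
  have hirr : Irr W 5 :=
    hasIrreducibleModPGaloisRep_of_intModel_of_noroot hIW 5 7 (by norm_num) (by decide +kernel)
      (natCard_point_eq_of_countPoints 1 (-1) 1 (-115603241180) (-15128723997763553) 7 (by norm_num)
        (by decide +kernel) (n := 4) (by decide +kernel)) (by decide)
  have hrank : W.mordellWeilRank + Module.finrank ℚ ℚ + 1 ≤ F.mordellWeilRank := by
    have h2 := two_le_rank_c201150c1
    have hE : (⟨1, -1, 1, -28055, 3766447⟩ : WeierstrassCurve ℤ).map (Int.castRingHom ℚ) =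
        (⟨1, -1, 1, -28055, 3766447⟩ : WeierstrassCurve ℚ) := by
      ext <;> simp [WeierstrassCurve.map]
    rw [hE] at h2
    rw [(hGZK W (by rw [hr0]; norm_num)).1, hr0, Module.finrank_self, hFeq]
    exact h2
  have hk2 : ∀ w : HeightOneSpectrum (𝓞 ℚ), (primesEquiv w : ℕ) = 2 →
      Nat.card (nsmulAddMonoidHom 5 : (F.baseChange (w.adicCompletion ℚ)).toAffine.Point →+ _).ker = 1 :=
    fun w hw ↦
      natCard_ker_nsmul_five_adicCompletion_eq_one_of_checkAt 2 1 (-1) 1 (-28055) 3766447 (by decide +kernel)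
        (k := 5) (cert := []) (by decide +kernel) F hFeq hw
  have hk3 : ∀ w : HeightOneSpectrum (𝓞 ℚ), (primesEquiv w : ℕ) = 3 →
      Nat.card (nsmulAddMonoidHom 5 : (F.baseChange (w.adicCompletion ℚ)).toAffine.Point →+ _).ker = 1 :=
    fun w hw ↦
      natCard_ker_nsmul_five_adicCompletion_eq_one_of_checkAt 3 1 (-1) 1 (-28055) 3766447 (by decide +kernel)
        (k := 2) (cert := []) (by decide +kernel) F hFeq hw
  have hk5 : ∀ w : HeightOneSpectrum (𝓞 ℚ), (primesEquiv w : ℕ) = 5 →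
      Nat.card (nsmulAddMonoidHom 5 : (F.baseChange (w.adicCompletion ℚ)).toAffine.Point →+ _).ker = 1 :=
    fun w hw ↦
      natCard_ker_nsmul_five_adicCompletion_eq_one_of_checkAt 5 1 (-1) 1 (-28055) 3766447 (by decide +kernel)
        (k := 2) (cert := []) (by decide +kernel) F hFeq hw
  set L : List ℕ := [2, 3, 5, 149] with hL
  have hLp : ∀ r ∈ L, r.Prime := by decide
  have hΔE : ∀ r : ℕ, r.Prime → (r : ℤ) ∣ (⟨1, -1, 1, -115603241180, -15128723997763553⟩ : WeierstrassCurve ℤ).Δ → r ∈ L :=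
    forall_mem_of_natAbs_eq_prod_pow L [16, 3, 8, 2] hLp (by decide +kernel)
  have hΔF : ∀ r : ℕ, r.Prime → (r : ℤ) ∣ (⟨1, -1, 1, -28055, 3766447⟩ : WeierstrassCurve ℤ).Δ → r ∈ L :=
    forall_mem_of_natAbs_eq_prod_pow L [12, 9, 8, 1] hLp (by decide +kernel)
  set S : Finset (HeightOneSpectrum (𝓞 ℚ)) :=
    (L.filterMap fun r ↦ if h : r.Prime then some ((primesEquiv (R := 𝓞 ℚ)).symm ⟨r, h⟩) else none).toFinset
    with hSdef
  have hS := good_outside_placesOfList' hLp (by decide) _ _ _ _ _ _ _ _ _ _ hΔE hΔF W F hWeq hFeq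
  have hplaces : ∀ w ∈ S,
      Nat.card (nsmulAddMonoidHom 5 : (F.baseChange (w.adicCompletion ℚ)).toAffine.Point →+ _).ker = 1 ∨
      (1 < w.valuation ℚ W.j ∧ 1 < w.valuation ℚ F.j ∧
        (∃ r : w.adicCompletion ℚ, algebraMap ℚ (w.adicCompletion ℚ) (-(W.c₄ / W.c₆)) =
          r ^ 2 * algebraMap ℚ (w.adicCompletion ℚ) (-(F.c₄ / F.c₆))) ∧
        (∀ ζ : w.adicCompletion ℚ, ζ ^ 5 = 1 → ζ = 1)) := by
    intro w hwS
    have hwL : (primesEquiv w : ℕ) ∈ L := (mem_placesOfList_iff' hLp w).mp hwS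
    have hcases : (primesEquiv w : ℕ) = 2 ∨ (primesEquiv w : ℕ) = 3 ∨ (primesEquiv w : ℕ) = 5 ∨ (primesEquiv w : ℕ) = 149 := by
      simp only [hL, List.mem_cons, List.mem_nil_iff, or_false] at hwL
      omega
    rcases hcases with hw | hw | hw | hw
    · exact Or.inl (hk2 w hw)
    · exact Or.inl (hk3 w hw)
    · exact Or.inl (hk5 w hw)
    · exact Or.inr (kindIIIPrime_v201150f1_at149 W F hWeq hFeq hw)
  exact missingLower5_of_visible' hCT hGZK W hr0 hq hv
    (Summit.BirchSwinnertonDyer.Rank1Residual.X4.exists_sha_ne_zero_of_congr_of_rank_add_of_freePlaces W F hU2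
      (by norm_num) θ hθ S hS
      ((natCard_torsionBy_point_eq_of_subsingleton W _ _ _).trans
        (natCard_torsionBy_eq_one_of_hasIrreducibleModPGaloisRep W 5 hirr)) hrank hplaces)

end Summit.BirchSwinnertonDyer.BirchSwinnertonDyer.Theorems.KTVis

end
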